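import Literature.NumberTheory.GaloisRepresentations.IdeleClassGroupLimitInflation
import Literature.NumberTheory.GaloisRepresentations.IdeleClassInvariantNaturality
import Literature.NumberTheory.GaloisRepresentations.IdeleClassInvariantDivisible
import Literature.Algebra.Homology.DiscreteRepLayerColimitDesc
import HarnessLib

/-!
# THE invariant map of the idèle class formation on the limit: `inv_F : H²(Γ_F, C̄) ⥲ ℚ/ℤ`
# (Tate, C–F VII §11.2 (bis) "passing to the limit"; Harari Thm. 13.23 / Def. 16.3; Milne ADT I §1)

Topic `NumberTheory/GaloisRepresentations`; namespace `Literature.NumberTheory.GaloisRepresentations.IdeleClassBar`.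
Sequel to door-c5 g16's `IdeleClassGroupLimitLayers.lean` / `IdeleClassGroupLimitInflation.lean` (`classBarD F = C̄` as an
object of door-c4's `C_Γ = DiscreteRepCat ℤ Γ_F`, `layerRep E = C̄^{U_E}`, `layerCohomologyIso E n : Hⁿ(Γ_F ⧸ U_E, C̄^{U_E})
≅ Hⁿ(Gal(E/F), C_E)`, door-c4's transition = `layerInf`/`classInf`), to `IdeleClassInvariant*.lean` (door-c5/door-c6:
`classInvAll F E : H²(Gal(E/F), C_E) →+ ℚ/ℤ` injective with image `(1/[E:F])ℤ/ℤ`, `classInvAll_classInf` = compatibility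
with inflation, `exists_layer_classInvAll_eq` = joint surjectivity) and to door-c4 g16's `DiscreteRepLayerColimitDesc.lean`
(descent of a compatible family of layer maps on a cofinal family of open normal subgroups to `Extⁿ_{C_Γ}(k, M)`).
Definitions with bodies (`layerInv`, `classBarInv`) and theorems; NO named fact, no `sorry`, no instance, no notation;
number fields in `Type`; `Γ_F = Field.absoluteGaloisGroup F`, taken profinite through the `Prop`-valued mixin
hypotheses `[CompactSpace Γ_F] [TotallyDisconnectedSpace Γ_F]` (both available: `absoluteGaloisGroup_compactSpace`,
Mathlib's Krull topology; supplied by `haveI` at use sites).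

Mathematics.  Tate (C–F VII §11.2 (bis), Result): the invariant maps `inv_{E/F} : H²(Gal(E/F), C_E) ⥲ (1/[E:F])ℤ/ℤ` of
the finite layers are compatible with inflation, hence ("passing to the limit") define
`inv_F : H²(F, C̄) = lim→_E H²(Gal(E/F), C_E) → ℚ/ℤ`, an ISOMORPHISM (injective on each layer; onto because every
`a/N ∈ ℚ/ℤ` is an invariant at a layer of degree divisible by `N`).  This is the datum `inv_G : H²(G, C) ⥲ ℚ/ℤ` of the
class formation `(Γ_F, C̄)` (Milne ADT I §1; Harari Def. 16.3 / Thm. 13.23), i.e. the `inv` of door-c4's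
`TateDualityHypotheses (classBarD F) inv` (`DiscreteRepTateDuality.lean`).  Here `H²(F, C̄)` is read as
`Ext²_{C_Γ}(ℤ, C̄)` through door-c4's colimit theorem (d) in `groupCohomology` currency (`DiscreteRep.LayerColimit.inflG`).

## What is formalised (`F : Type` a number field, `Γ = absoluteGaloisGroup F`)

* `layerInv E : H²(Γ ⧸ U_E, C̄^{U_E}) →+ ℚ/ℤ` (`= inv_{E/F} ∘ layerCohomologyIso`), `layerInv_apply`, `layerInv_injective`,
  **`isCompatibleFamily_layerInv`** (cofinal over `E ↦ U_E` and compatible with door-c4's transitions `stepG`, by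
  `map_invariantsStepIncl_comp_layerCohomologyIso` + `classInvAll_classInf`);
* **`classBarInv F : Ext²_{C_Γ}(ℤ, C̄) →+ ℚ/ℤ`** (= `LayerColimit.desc`), **`classBarInv_inflG`**
  (`inv_F (Inf_E c) = inv_{E/F}(iso_E c)`), `classBarInv_inflG_layerCohomologyIso_inv` (`inv_F (Inf_E (iso_E⁻¹ y)) = inv_{E/F} y`),
  `classBarInv_inflG_fundamentalClassAll` (`= 1/[E:F]`);
* **`classBarInv_injective`**, **`classBarInv_surjective`**, **`classBarInv_bijective`**; uniqueness
  `eq_classBarInv_of_forall_inflG`.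

HONEST FRAMING: classical global class field theory in the tree's normalisation; no case of BSD or of Poitou–Tate is
proved.  This is field `inv` (and the `U = Γ` core of `invAt_bijective`) of the arithmetic instantiation of door-c4's Tate
duality theorem for crux `AnticycControlAdditiveK` (item 19295, cell bsd-schneider); the open-subgroup level
(`inv_U` on the trace layers, `inv_U ∘ res = [Γ:U] • inv_F`) is the sequel.

## References
* J. W. S. Cassels, A. Fröhlich (eds.), *Algebraic Number Theory* (1967), Ch. VII (J. Tate) §11.2 (bis) "RESULT" and the
  passage to the limit `H²(K, C) = ⋃ H²(L/K, C_L)`. [CasselsFrohlichANT1967]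
* D. Harari, *Galois Cohomology and Class Field Theory*, Universitext (2020), §13.4 Theorem 13.23, §16.1 Definition 16.3. [Harari2020]
* J. S. Milne, *Arithmetic Duality Theorems* (2nd ed. 2006), I §1 (class formations: `inv_G : H²(G, C) ⥲ ℚ/ℤ`). [MilneADT2006]
-/

noncomputable section

open NumberField CategoryTheory groupCohomology
open Field (absoluteGaloisGroup)
open Literature.NumberTheory.Automorphic Literature.NumberTheory.Automorphic.IdeleClassGroup
open Literature.NumberTheory.NumberFields
open Literature.Algebra.Homology Literature.Algebra.Homology.DiscreteRep
open Literature.AnabelianGeometry.AbsoluteAnabelian.Prop121vii (zmodToQmodZ)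
open scoped Classical

namespace Literature.NumberTheory.GaloisRepresentations

namespace IdeleClassBar

variable (F : Type) [Field F] [NumberField F]

/-! ## §12. The invariant maps of the layers of `C̄`, as a compatible family over `E ↦ U_E` -/

variable {F} in
/-- **The invariant map of the layer `C̄^{U_E}`**: `inv_{E/F} ∘ (Hⁿ(Γ_F ⧸ U_E, C̄^{U_E}) ≅ H²(Gal(E/F), C_E))`
(door-c5/door-c6's `classInvAll F E` transported along door-c5's `layerCohomologyIso E 2`).
[cite: CasselsFrohlichANT1967, Ch. VII §11.2 (bis)] -/
def layerInv (E : GalLayer F) : groupCohomology (layerRep E) 2 →+ AddCircle (1 : ℚ) :=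
  haveI := E.numberField
  haveI := E.isGalois
  AddMonoidHom.mk' (fun c => IdeleCohomology.classInvAll F E.1 ((layerCohomologyIso E 2).hom c)) fun c c' => by
    rw [map_add, map_add]

variable {F} in
/-- Formula: `layerInv E c = inv_{E/F} (iso_E c)`. [cite: CasselsFrohlichANT1967, Ch. VII §11.2 (bis)] -/
theorem layerInv_apply (E : GalLayer F) (c : groupCohomology (layerRep E) 2) :
    layerInv E c = (haveI := E.numberField; haveI := E.isGalois;
      IdeleCohomology.classInvAll F E.1 ((layerCohomologyIso E 2).hom c)) := by
  rw [layerInv, AddMonoidHom.mk'_apply]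

variable {F} in
/-- `layerInv E (iso_E⁻¹ y) = inv_{E/F} y`. [cite: CasselsFrohlichANT1967, Ch. VII §11.2 (bis)] -/
theorem layerInv_layerCohomologyIso_inv (E : GalLayer F)
    (y : groupCohomology (haveI := E.numberField; IdeleClassGroup.galoisRep F E.1) 2) :
    layerInv E ((layerCohomologyIso E 2).inv y) =
      (haveI := E.numberField; haveI := E.isGalois; IdeleCohomology.classInvAll F E.1 y) := by
  rw [layerInv_apply, ← ModuleCat.comp_apply, Iso.inv_hom_id, ModuleCat.id_apply]

variable {F} in
/-- **`layerInv E` is injective** (`inv_{E/F}` is, and `layerCohomologyIso` is an isomorphism).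
[cite: CasselsFrohlichANT1967, Ch. VII §11.2 (bis), Result] -/
theorem layerInv_injective (E : GalLayer F) : Function.Injective (layerInv E) := by
  haveI := E.numberField
  haveI := E.isGalois
  intro c c' h
  rw [layerInv_apply, layerInv_apply] at h
  have h' := IdeleCohomology.classInvAll_injective F E.1 h
  have := congrArg (layerCohomologyIso E 2).inv h'
  rwa [← ModuleCat.comp_apply, ← ModuleCat.comp_apply, Iso.hom_inv_id, ModuleCat.id_apply,
    ModuleCat.id_apply] at this

variable {F} in
/-- **Compatibility of the layer invariants with door-c4's transitions**: for `E ≤ E'`,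
`layerInv E' (Hⁿ(quotMap, incl) c) = layerInv E c` (the transition is `layerInf`/`classInf` under the isomorphisms,
and `inv_{E'/F} ∘ Inf = inv_{E/F}`). [cite: CasselsFrohlichANT1967, Ch. VII §11.2 (diagram (4)) and (bis)] -/
theorem layerInv_stepG {E E' : GalLayer F} (h : E ≤ E') (c : groupCohomology (layerRep E) 2) :
    layerInv E' (LayerColimit.stepG E.openNormalSubgroup E'.openNormalSubgroup
        (GalLayer.coe_openNormalSubgroup_le h) (classBarD F) 2 c) = layerInv E c := by
  haveI := E.numberField
  haveI := E'.numberField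
  haveI := E.isGalois
  haveI := E'.isGalois
  have key : (layerCohomologyIso E' 2).hom (LayerColimit.stepG E.openNormalSubgroup E'.openNormalSubgroup
      (GalLayer.coe_openNormalSubgroup_le h) (classBarD F) 2 c) = layerInf E E' h 2 ((layerCohomologyIso E 2).hom c) := by
    rw [← ModuleCat.comp_apply, map_invariantsStepIncl_comp_layerCohomologyIso h 2, ModuleCat.comp_apply]
  rw [layerInv_apply, layerInv_apply, key]
  by_cases heq : E = E'
  · subst heq
    rw [layerInf_self, ModuleCat.id_apply]
  · rw [layerInf_of_ne h heq]
    letI := GalLayer.algebraOfLE h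
    haveI := GalLayer.isScalarTower_of_le h
    exact IdeleCohomology.classInvAll_classInf F E.1 E'.1 _

/-- **The layer invariants form a compatible family on the cofinal family `E ↦ U_E` of open normal subgroups of
`Γ_F`** (every open normal subgroup IS some `U_E`; compatibility `layerInv_stepG`).
[cite: CasselsFrohlichANT1967, Ch. VII §11.2 (bis)][cite: SerreGaloisCohomology1997, I §2.2 Proposition 8] -/
theorem isCompatibleFamily_layerInv :
    LayerColimit.IsCompatibleFamily (fun E : GalLayer F => E.openNormalSubgroup) (classBarD F) 2
      (fun E => layerInv E) := by
  refine ⟨fun W => ⟨GalLayer.ofOpenNormalSubgroup W, ?_⟩, fun E E' h c => ?_⟩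
  · rw [GalLayer.openNormalSubgroup_ofOpenNormalSubgroup]
  · have h' : E ≤ E' := GalLayer.openNormalSubgroup_le_iff.1 fun x hx => h hx
    exact layerInv_stepG h' c

/-! ## §13. THE invariant map `inv_F : Ext²_{C_Γ}(ℤ, C̄) →+ ℚ/ℤ` -/

section Limit

variable [CompactSpace (absoluteGaloisGroup F)] [TotallyDisconnectedSpace (absoluteGaloisGroup F)]

/-- **THE invariant map of the idèle class formation, `inv_F : H²(Γ_F, C̄) = Ext²_{C_Γ}(ℤ, C̄) →+ ℚ/ℤ`** — the descent
to door-c4's colimit of the compatible family of layer invariants `inv_{E/F}` (Tate: passage to the limit over the finite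
layers). [cite: CasselsFrohlichANT1967, Ch. VII §11.2 (bis)][cite: Harari2020, §16.1 Definition 16.3][cite: MilneADT2006, I §1] -/
def classBarInv : Abelian.Ext (triv (k := ℤ) (Γ := absoluteGaloisGroup F) ℤ) (classBarD F) 2 →+ AddCircle (1 : ℚ) :=
  LayerColimit.desc (fun E : GalLayer F => E.openNormalSubgroup) (classBarD F) 2 (fun E => layerInv E)
    (isCompatibleFamily_layerInv F)

variable {F}

/-- **`inv_F (Inf_E c) = inv_{E/F} (iso_E c)`**: on a class inflated from the layer `E`, `inv_F` is the layer invariant.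
[cite: CasselsFrohlichANT1967, Ch. VII §11.2 (bis)][cite: Harari2020, §16.1 Definition 16.3] -/
theorem classBarInv_inflG (E : GalLayer F) (c : groupCohomology (layerRep E) 2) :
    classBarInv F (LayerColimit.inflG E.openNormalSubgroup (classBarD F) 2 c) = layerInv E c :=
  LayerColimit.desc_inflG (isCompatibleFamily_layerInv F) E c

/-- `inv_F (Inf_E (iso_E⁻¹ y)) = inv_{E/F} y` for `y ∈ H²(Gal(E/F), C_E)`.
[cite: CasselsFrohlichANT1967, Ch. VII §11.2 (bis)] -/
theorem classBarInv_inflG_layerCohomologyIso_inv (E : GalLayer F)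
    (y : groupCohomology (haveI := E.numberField; IdeleClassGroup.galoisRep F E.1) 2) :
    classBarInv F (LayerColimit.inflG E.openNormalSubgroup (classBarD F) 2 ((layerCohomologyIso E 2).inv y)) =
      (haveI := E.numberField; haveI := E.isGalois; IdeleCohomology.classInvAll F E.1 y) := by
  rw [classBarInv_inflG, layerInv_layerCohomologyIso_inv]

/-- **`inv_F` of the inflated fundamental class `u_{E/F}` is `1/[E:F]`.**
[cite: CasselsFrohlichANT1967, Ch. VII §11.2 (bis), Result] -/
theorem classBarInv_inflG_fundamentalClassAll (E : GalLayer F) :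
    haveI := E.numberField; haveI := E.isGalois; haveI := IdeleCohomology.neZero_finrank F E.1
    classBarInv F (LayerColimit.inflG E.openNormalSubgroup (classBarD F) 2 ((layerCohomologyIso E 2).inv
        (IdeleCohomology.fundamentalClassAll F E.1))) = zmodToQmodZ (Module.finrank F E.1) 1 := by
  haveI := E.numberField
  haveI := E.isGalois
  rw [classBarInv_inflG_layerCohomologyIso_inv]
  exact IdeleCohomology.classInvAll_fundamentalClassAll F E.1

/-- On a class inflated from an arbitrary open normal subgroup `W`: `inv_F (Inf_W c) = inv_{E/F}(iso_E (Inf_{W → U_E} c))`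
for any layer `E` with `U_E ≤ W`. [cite: CasselsFrohlichANT1967, Ch. VII §11.2 (bis)] -/
theorem classBarInv_inflG_of_le (W : OpenNormalSubgroup (absoluteGaloisGroup F)) {E : GalLayer F}
    (hE : (E.openNormalSubgroup : Subgroup (absoluteGaloisGroup F)) ≤ W)
    (c : groupCohomology ((invariantsQuotFunctor ℤ (W : Subgroup (absoluteGaloisGroup F))).obj (classBarD F)) 2) :
    classBarInv F (LayerColimit.inflG W (classBarD F) 2 c) =
      layerInv E (LayerColimit.stepG W E.openNormalSubgroup hE (classBarD F) 2 c) :=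
  LayerColimit.desc_inflG_of_le (isCompatibleFamily_layerInv F) W hE c

/-- **Uniqueness**: an additive map `Ext²_{C_Γ}(ℤ, C̄) → ℚ/ℤ` agreeing with `inv_{E/F}` on every layer is `inv_F`.
[cite: Harari2020, §16.1 Definition 16.3] -/
theorem eq_classBarInv_of_forall_inflG
    (g : Abelian.Ext (triv (k := ℤ) (Γ := absoluteGaloisGroup F) ℤ) (classBarD F) 2 →+ AddCircle (1 : ℚ))
    (hg : ∀ (E : GalLayer F) (c : groupCohomology (layerRep E) 2),
      g (LayerColimit.inflG E.openNormalSubgroup (classBarD F) 2 c) = layerInv E c) :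
    g = classBarInv F :=
  LayerColimit.eq_desc_of_forall_inflG (isCompatibleFamily_layerInv F) g hg

variable (F)

/-- **`inv_F` is injective** (each `inv_{E/F}` is). [cite: CasselsFrohlichANT1967, Ch. VII §11.2 (bis), Result] -/
theorem classBarInv_injective : Function.Injective (classBarInv F) :=
  LayerColimit.desc_injective (isCompatibleFamily_layerInv F) fun E => layerInv_injective E

/-- **`inv_F` is surjective**: every `t ∈ ℚ/ℤ` is `inv_{E/F}` of a class at some finite Galois layer `E ⊆ F̄`
(door-c6 `exists_layer_classInvAll_eq`). [cite: CasselsFrohlichANT1967, Ch. VII §11.2 (bis)] -/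
theorem classBarInv_surjective : Function.Surjective (classBarInv F) := by
  refine LayerColimit.desc_surjective (isCompatibleFamily_layerInv F) fun t => ?_
  obtain ⟨M, hfin, hgal, hnf, y, hy⟩ := IdeleCohomology.exists_layer_classInvAll_eq F F t
  let E : GalLayer F := ⟨M, hfin, hgal⟩
  refine ⟨E, (layerCohomologyIso E 2).inv y, ?_⟩
  rw [layerInv_layerCohomologyIso_inv]
  exact hy

/-- **`inv_F : H²(Γ_F, C̄) → ℚ/ℤ` is bijective** — the invariant isomorphism of the idèle class formation in the limit
(the hypothesis `inv` bijective of door-c4's Tate duality theorem for `(Γ_F, C̄)`).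
[cite: CasselsFrohlichANT1967, Ch. VII §11.2 (bis)][cite: Harari2020, §13.4 Theorem 13.23][cite: MilneADT2006, I §1] -/
theorem classBarInv_bijective : Function.Bijective (classBarInv F) :=
  ⟨classBarInv_injective F, classBarInv_surjective F⟩

/-- `inv_F x = 0 ↔ x = 0`. [cite: CasselsFrohlichANT1967, Ch. VII §11.2 (bis), Result] -/
theorem classBarInv_eq_zero_iff (x : Abelian.Ext (triv (k := ℤ) (Γ := absoluteGaloisGroup F) ℤ) (classBarD F) 2) :
    classBarInv F x = 0 ↔ x = 0 :=
  ⟨fun h => classBarInv_injective F (h.trans (map_zero _).symm), fun h => by rw [h, map_zero]⟩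

end Limit

end IdeleClassBar

end Literature.NumberTheory.GaloisRepresentations

end
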